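import Summits.QuantumFields.YangMills.Theorems.VirialFluxGapFixCoordDefs
import Summits.QuantumFields.YangMills.Theorems.VirialFluxGapFixSliceChartLocal
import Literature.Probability.Distributions.GaussianPiDensity
import Summits.QuantumFields.YangMills.Theorems.LuscherReductionTwistedTraceScalingChartTransport
import HarnessLib

/-!
# The Euclidean model `V = ℝ^{fixDim}` of the slice coordinates: volume preservation and measurable-equivalence of `fixCoord`
# (layer (B2) of the DIRECT Laplace road to ⟨stmt-QuantumFields-24204⟩ `VirialFluxGap.SharpTwistedLaplace`)

Helper module (free-hands work of width seat ym-line-sfw-p2-w3 g57, cell ym-idea-1; `--supports 24204`).  Theorems about the definitions of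
✓`VirialFluxGapFixCoordDefs` (`FixIdx`, `fixDim`, `fixIdxEquiv`, `fixCoord : EuclideanSpace ℝ (Fin fixDim) → ℝ³ × RestParam`, `restLebesgue`):
* §1 generic measure theory: `lintegral_fintype_prod_eq_prod` (Tonelli for finite products, any finite index type; from the `Fin n` version
  ✓`Literature.Probability.Distributions.lintegral_fin_nat_prod_eq_prod`), `pi_withDensity` (`⊗ᵢ(fᵢ·μᵢ) = (∏ᵢ fᵢ)·⊗ᵢμᵢ`), `prod_withDensity'` (currying is
  ✓`GnChart.measurePreserving_curry_pi` of `…TwistedTraceScalingChartTransport`);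
* §2 `fixCoord`: coordinate formulas, injectivity, continuity, measurability, the block decomposition of `‖y‖²` and the block-norm bounds
  `‖a‖, ‖b_c‖ ≤ ‖y‖`;
* §3 ★ `measurePreserving_fixCoord` — `fixCoord_* vol_V = Leb³ ⊗ restLebesgue` (Mathlib: `EuclideanSpace.volume_preserving_symm_measurableEquiv_toLp`,
  `measurePreserving_sumPiEquivProdPi`, `measurePreserving_piCongrLeft`, `measurePreserving_pi`, `PiLp.volume_preserving_toLp` + currying);
* §4 ★ `measurableEmbedding_fixCoord` (explicit block-writing inverse).
The model is indexed by `Fin fixDim` (not by the structured `FixIdx`) because type-class search for `MeasureSpace ∕ BorelSpace` on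
`EuclideanSpace ℝ FixIdx` does not terminate on this tree (a `Zero ?m` subgoal explodes); with `Fin n` it is instant.
Everything here is PROVED; no definitions, no named facts.  HONEST FRAMING: measure-theoretic plumbing; ⟨24204⟩, ⟨24319⟩ and every rung stay OPEN;
the Yang–Mills mass gap (Clay) is NOT touched; no summit is proved by a line.

## References
* K. W. Breitung, *Asymptotic Approximations for Probability Integrals*, LNM 1592 (1994), §2.3 Definitions 4–5. [Breitung1994]
* S. Helgason, *Groups and Geometric Analysis* (2000), Ch. I §1 Thm 1.14. [Helgason2000]
-/

set_option autoImplicit false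

noncomputable section

open MeasureTheory Set Filter Metric WithLp
open scoped ENNReal RealInnerProductSpace
open Literature.MathematicalPhysics.QuantumLattice
open Literature.MathematicalPhysics.QuantumFieldTheory hiding SU2
open Literature.MathematicalPhysics.QuantumFieldTheory.Balaban1983to89.T4HaarSU2ExpChart
open Literature.MathematicalPhysics.QuantumFieldTheory.Balaban1983to89.T4ExpWindowSmallField
open Summit.QuantumFields.YangMills.Theorems.FemtoTransferGap
open Summit.QuantumFields.YangMills.Theorems.FemtoTransferGap.TT
open Summit.QuantumFields.YangMills.Theorems.VirialFluxGap.AnchorSlice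
open Summit.QuantumFields.YangMills.Theorems.VirialFluxGap.ConjChart
open Summit.QuantumFields.YangMills.Theorems.VirialFluxGap.ChartTensor

namespace Summit.QuantumFields.YangMills.Theorems.VirialFluxGap.FixSplit

/-! ## §1 Generic: Tonelli for finite products, products of measures with densities, currying -/

section Generic

/-- **Tonelli for finite products** (any finite index type). [folklore] -/
theorem lintegral_fintype_prod_eq_prod {ι : Type*} [Fintype ι] {E : ι → Type*} {mE : ∀ i, MeasurableSpace (E i)}
    (μ : ∀ i, Measure (E i)) [∀ i, SigmaFinite (μ i)] (f : ∀ i, E i → ℝ≥0∞) (hf : ∀ i, Measurable (f i)) :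
    ∫⁻ x, ∏ i, f i (x i) ∂(Measure.pi μ) = ∏ i, ∫⁻ x, f i x ∂(μ i) := by
  let e := (Fintype.equivFin ι).symm
  rw [← (measurePreserving_piCongrLeft μ e).lintegral_comp_emb (MeasurableEquiv.measurableEmbedding _)]
  simp_rw [← e.prod_comp, MeasurableEquiv.coe_piCongrLeft, Equiv.piCongrLeft_apply_apply]
  exact Literature.Probability.Distributions.lintegral_fin_nat_prod_eq_prod _ _ fun i => hf _

/-- **A finite product of measures with densities is the product measure with the product density.** [folklore] -/
theorem pi_withDensity {ι : Type*} [Fintype ι] {E : ι → Type*} {mE : ∀ i, MeasurableSpace (E i)}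
    (μ : ∀ i, Measure (E i)) [∀ i, SigmaFinite (μ i)] (f : ∀ i, E i → ℝ≥0∞) (hf : ∀ i, Measurable (f i))
    [∀ i, SigmaFinite ((μ i).withDensity (f i))] :
    Measure.pi (fun i => (μ i).withDensity (f i)) = (Measure.pi μ).withDensity fun x => ∏ i, f i (x i) := by
  refine Measure.pi_eq fun s hs => ?_
  rw [withDensity_apply _ (MeasurableSet.univ_pi hs), Measure.restrict_pi_pi, lintegral_fintype_prod_eq_prod _ _ hf]
  exact Finset.prod_congr rfl fun i _ => (withDensity_apply _ (hs i)).symm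

/-- Product of two measures with densities. [folklore] -/
theorem prod_withDensity' {α β : Type*} [MeasurableSpace α] [MeasurableSpace β] (μ : Measure α) (ν : Measure β) [SFinite μ] [SFinite ν]
    {f : α → ℝ≥0∞} {g : β → ℝ≥0∞} (hf : Measurable f) (hg : Measurable g) :
    (μ.withDensity f).prod (ν.withDensity g) = (μ.prod ν).withDensity fun z => f z.1 * g z.2 := by
  rw [prod_withDensity_left hf, prod_withDensity_right hg,
    ← withDensity_mul _ (show Measurable fun z : α × β => g z.2 from hg.comp measurable_snd)
      (show Measurable fun z : α × β => f z.1 from hf.comp measurable_fst)]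
  congr 1
  funext z
  simp only [Pi.mul_apply]
  rw [mul_comm]

end Generic

variable {L : ℕ} [NeZero L] {e₀ : OffIdx L} {y₀ : Site 3 L}

/-! ## §2 Basic properties of `fixCoord` -/

/-- Coordinates of the seam∕link block. -/
@[simp] theorem fixCoord_fst_apply (y : EuclideanSpace ℝ (Fin (fixDim L e₀ y₀))) (m : Fin 3) :
    (fixCoord y).1 m = y (fixIdxEquiv L e₀ y₀ (Sum.inl m)) := rfl

/-- Coordinates of an off-tree block. -/
@[simp] theorem fixCoord_snd_fst_apply (y : EuclideanSpace ℝ (Fin (fixDim L e₀ y₀))) (i : {i : OffIdx L // ¬ i = e₀}) (m : Fin 3) :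
    (fixCoord y).2.1 i m = y (fixIdxEquiv L e₀ y₀ (Sum.inr (Sum.inl (i, m)))) := rfl

/-- Coordinates of a slice-link block. -/
@[simp] theorem fixCoord_snd_snd_fst_apply (y : EuclideanSpace ℝ (Fin (fixDim L e₀ y₀))) (j : Fin (2 * L - 1)) (e : Edge 3 L)
    (m : Fin 3) : (fixCoord y).2.2.1 j e m = y (fixIdxEquiv L e₀ y₀ (Sum.inr (Sum.inr (Sum.inl ((j, e), m))))) := rfl

/-- Coordinates of a site block. -/
@[simp] theorem fixCoord_snd_snd_snd_apply (y : EuclideanSpace ℝ (Fin (fixDim L e₀ y₀))) (s : {y : Site 3 L // ¬ y = y₀}) (m : Fin 3) :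
    (fixCoord y).2.2.2 s m = y (fixIdxEquiv L e₀ y₀ (Sum.inr (Sum.inr (Sum.inr (s, m))))) := rfl

/-- `fixCoord` is injective. -/
theorem fixCoord_injective : Function.Injective (fixCoord (L := L) (e₀ := e₀) (y₀ := y₀)) := by
  intro y y' h
  ext k
  obtain ⟨idx, rfl⟩ := (fixIdxEquiv L e₀ y₀).surjective k
  rcases idx with m | ⟨i, m⟩ | ⟨⟨j, e⟩, m⟩ | ⟨s, m⟩
  · simpa using congrArg (fun p : EuclideanSpace ℝ (Fin 3) × RestParam L e₀ y₀ => p.1 m) h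
  · simpa using congrArg (fun p : EuclideanSpace ℝ (Fin 3) × RestParam L e₀ y₀ => p.2.1 i m) h
  · simpa using congrArg (fun p : EuclideanSpace ℝ (Fin 3) × RestParam L e₀ y₀ => p.2.2.1 j e m) h
  · simpa using congrArg (fun p : EuclideanSpace ℝ (Fin 3) × RestParam L e₀ y₀ => p.2.2.2 s m) h

/-- `fixCoord` is continuous. -/
theorem continuous_fixCoord : Continuous (fixCoord (L := L) (e₀ := e₀) (y₀ := y₀)) := by
  have hc : ∀ k : Fin (fixDim L e₀ y₀), Continuous fun y : EuclideanSpace ℝ (Fin (fixDim L e₀ y₀)) => y k := fun k =>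
    (EuclideanSpace.proj k : EuclideanSpace ℝ (Fin (fixDim L e₀ y₀)) →L[ℝ] ℝ).continuous
  unfold fixCoord
  refine Continuous.prodMk ?_ (Continuous.prodMk ?_ (Continuous.prodMk ?_ ?_))
  · exact (PiLp.continuous_toLp 2 _).comp (continuous_pi fun m => hc _)
  · exact continuous_pi fun i => (PiLp.continuous_toLp 2 _).comp (continuous_pi fun m => hc _)
  · exact continuous_pi fun j => continuous_pi fun e => (PiLp.continuous_toLp 2 _).comp (continuous_pi fun m => hc _)
  · exact continuous_pi fun s => (PiLp.continuous_toLp 2 _).comp (continuous_pi fun m => hc _)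

/-- `fixCoord` is measurable. -/
theorem measurable_fixCoord : Measurable (fixCoord (L := L) (e₀ := e₀) (y₀ := y₀)) := by
  have hc : ∀ k : Fin (fixDim L e₀ y₀), Measurable fun y : EuclideanSpace ℝ (Fin (fixDim L e₀ y₀)) => y k := fun k =>
    (EuclideanSpace.proj k : EuclideanSpace ℝ (Fin (fixDim L e₀ y₀)) →L[ℝ] ℝ).continuous.measurable
  have hb : ∀ g : Fin 3 → Fin (fixDim L e₀ y₀), Measurable fun y : EuclideanSpace ℝ (Fin (fixDim L e₀ y₀)) =>
      (toLp 2 fun m => y (g m) : EuclideanSpace ℝ (Fin 3)) := fun g =>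
    (WithLp.measurable_toLp 2 _).comp (measurable_pi_lambda _ fun m => hc _)
  unfold fixCoord
  refine Measurable.prodMk (hb _) (Measurable.prodMk ?_ (Measurable.prodMk ?_ ?_))
  · exact measurable_pi_lambda _ fun i => hb _
  · exact measurable_pi_lambda _ fun j => measurable_pi_lambda _ fun e => hb _
  · exact measurable_pi_lambda _ fun s => hb _

/-- The squared norm of `y` splits over the blocks. -/
theorem norm_sq_eq_blocks (y : EuclideanSpace ℝ (Fin (fixDim L e₀ y₀))) :
    ‖y‖ ^ 2 = ‖(fixCoord y).1‖ ^ 2 + ((∑ i, ‖(fixCoord y).2.1 i‖ ^ 2) +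
      ((∑ je : Fin (2 * L - 1) × Edge 3 L, ‖(fixCoord y).2.2.1 je.1 je.2‖ ^ 2) + ∑ s, ‖(fixCoord y).2.2.2 s‖ ^ 2)) := by
  rw [EuclideanSpace.norm_sq_eq, ← (fixIdxEquiv L e₀ y₀).sum_comp, Fintype.sum_sum_type, Fintype.sum_sum_type,
    Fintype.sum_sum_type]
  congr 1
  · rw [EuclideanSpace.norm_sq_eq]; rfl
  congr 1
  · rw [Fintype.sum_prod_type]
    exact Finset.sum_congr rfl fun i _ => by rw [EuclideanSpace.norm_sq_eq]; rfl
  congr 1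
  · rw [Fintype.sum_prod_type]
    exact Finset.sum_congr rfl fun je _ => by rw [EuclideanSpace.norm_sq_eq]; rfl
  · rw [Fintype.sum_prod_type]
    exact Finset.sum_congr rfl fun s _ => by rw [EuclideanSpace.norm_sq_eq]; rfl

/-- Block norms are bounded by the total norm: seam∕link block. -/
theorem norm_fixCoord_fst_le (y : EuclideanSpace ℝ (Fin (fixDim L e₀ y₀))) : ‖(fixCoord y).1‖ ≤ ‖y‖ := by
  refine (pow_le_pow_iff_left₀ (norm_nonneg _) (norm_nonneg _) two_ne_zero).mp ?_
  rw [norm_sq_eq_blocks y]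
  have h1 := Finset.sum_nonneg fun i (_ : i ∈ Finset.univ) => sq_nonneg ‖(fixCoord y).2.1 i‖
  have h2 := Finset.sum_nonneg fun je (_ : je ∈ (Finset.univ : Finset (Fin (2 * L - 1) × Edge 3 L))) =>
    sq_nonneg ‖(fixCoord y).2.2.1 je.1 je.2‖
  have h3 := Finset.sum_nonneg fun s (_ : s ∈ Finset.univ) => sq_nonneg ‖(fixCoord y).2.2.2 s‖
  linarith

/-- Block norms are bounded by the total norm: off-tree blocks. -/
theorem norm_fixCoord_snd_fst_le (y : EuclideanSpace ℝ (Fin (fixDim L e₀ y₀))) (i : {i : OffIdx L // ¬ i = e₀}) :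
    ‖(fixCoord y).2.1 i‖ ≤ ‖y‖ := by
  refine (pow_le_pow_iff_left₀ (norm_nonneg _) (norm_nonneg _) two_ne_zero).mp ?_
  rw [norm_sq_eq_blocks y]
  have h1 : ‖(fixCoord y).2.1 i‖ ^ 2 ≤ ∑ i, ‖(fixCoord y).2.1 i‖ ^ 2 :=
    Finset.single_le_sum (fun i _ => sq_nonneg ‖(fixCoord y).2.1 i‖) (Finset.mem_univ i)
  have h2 := Finset.sum_nonneg fun je (_ : je ∈ (Finset.univ : Finset (Fin (2 * L - 1) × Edge 3 L))) =>
    sq_nonneg ‖(fixCoord y).2.2.1 je.1 je.2‖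
  have h3 := Finset.sum_nonneg fun s (_ : s ∈ Finset.univ) => sq_nonneg ‖(fixCoord y).2.2.2 s‖
  have h0 := sq_nonneg ‖(fixCoord y).1‖
  linarith

/-- Block norms are bounded by the total norm: slice-link blocks. -/
theorem norm_fixCoord_snd_snd_fst_le (y : EuclideanSpace ℝ (Fin (fixDim L e₀ y₀))) (j : Fin (2 * L - 1)) (e : Edge 3 L) :
    ‖(fixCoord y).2.2.1 j e‖ ≤ ‖y‖ := by
  refine (pow_le_pow_iff_left₀ (norm_nonneg _) (norm_nonneg _) two_ne_zero).mp ?_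
  rw [norm_sq_eq_blocks y]
  have h1 := Finset.sum_nonneg fun i (_ : i ∈ Finset.univ) => sq_nonneg ‖(fixCoord y).2.1 i‖
  have h2 : ‖(fixCoord y).2.2.1 j e‖ ^ 2 ≤ ∑ je : Fin (2 * L - 1) × Edge 3 L, ‖(fixCoord y).2.2.1 je.1 je.2‖ ^ 2 := by
    have := Finset.single_le_sum (f := fun je : Fin (2 * L - 1) × Edge 3 L => ‖(fixCoord y).2.2.1 je.1 je.2‖ ^ 2)
      (fun je _ => sq_nonneg _) (Finset.mem_univ (j, e))
    exact this
  have h3 := Finset.sum_nonneg fun s (_ : s ∈ Finset.univ) => sq_nonneg ‖(fixCoord y).2.2.2 s‖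
  have h0 := sq_nonneg ‖(fixCoord y).1‖
  linarith

/-- Block norms are bounded by the total norm: site blocks. -/
theorem norm_fixCoord_snd_snd_snd_le (y : EuclideanSpace ℝ (Fin (fixDim L e₀ y₀))) (s : {y : Site 3 L // ¬ y = y₀}) :
    ‖(fixCoord y).2.2.2 s‖ ≤ ‖y‖ := by
  refine (pow_le_pow_iff_left₀ (norm_nonneg _) (norm_nonneg _) two_ne_zero).mp ?_
  rw [norm_sq_eq_blocks y]
  have h1 := Finset.sum_nonneg fun i (_ : i ∈ Finset.univ) => sq_nonneg ‖(fixCoord y).2.1 i‖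
  have h2 := Finset.sum_nonneg fun je (_ : je ∈ (Finset.univ : Finset (Fin (2 * L - 1) × Edge 3 L))) =>
    sq_nonneg ‖(fixCoord y).2.2.1 je.1 je.2‖
  have h3 : ‖(fixCoord y).2.2.2 s‖ ^ 2 ≤ ∑ s, ‖(fixCoord y).2.2.2 s‖ ^ 2 :=
    Finset.single_le_sum (fun s _ => sq_nonneg ‖(fixCoord y).2.2.2 s‖) (Finset.mem_univ s)
  have h0 := sq_nonneg ‖(fixCoord y).1‖
  linarith

/-! ## §3 `fixCoord` is volume preserving -/

/-- ★ **`fixCoord` carries Lebesgue measure on `V = ℝ^{18L⁴}` to `Leb³ ⊗ restLebesgue`.** [folklore] -/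
theorem measurePreserving_fixCoord :
    MeasurePreserving (fixCoord (L := L) (e₀ := e₀) (y₀ := y₀)) volume
      ((volume : Measure (EuclideanSpace ℝ (Fin 3))).prod (restLebesgue L e₀ y₀)) := by
  -- blocks
  have hE : MeasurePreserving (@toLp 2 (Fin 3 → ℝ)) (Measure.pi fun _ => volume) volume := PiLp.volume_preserving_toLp (Fin 3)
  have hB : ∀ (ι : Type) [Fintype ι], MeasurePreserving
      (fun (a : ι × Fin 3 → ℝ) (i : ι) => (toLp 2 (Function.curry a i) : EuclideanSpace ℝ (Fin 3)))
      (Measure.pi fun _ : ι × Fin 3 => (volume : Measure ℝ)) (Measure.pi fun _ : ι => (volume : Measure (EuclideanSpace ℝ (Fin 3)))) := by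
    intro ι _
    exact (measurePreserving_pi (fun _ : ι => Measure.pi fun _ : Fin 3 => (volume : Measure ℝ))
      (fun _ => (volume : Measure (EuclideanSpace ℝ (Fin 3)))) (fun _ => hE)).comp (FemtoTransferGap.TwoLattice.GnChart.measurePreserving_curry_pi ι (Fin 3) ℝ volume)
  have hB₁ := hB {i : OffIdx L // ¬ i = e₀}
  have hB₃ := hB {y : Site 3 L // ¬ y = y₀}
  have hB₂ : MeasurePreserving
      (fun (a : (Fin (2 * L - 1) × Edge 3 L) × Fin 3 → ℝ) (j : Fin (2 * L - 1)) (e : Edge 3 L) =>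
        (toLp 2 (Function.curry a (j, e)) : EuclideanSpace ℝ (Fin 3)))
      (Measure.pi fun _ => (volume : Measure ℝ))
      (Measure.pi fun _ : Fin (2 * L - 1) => Measure.pi fun _ : Edge 3 L => (volume : Measure (EuclideanSpace ℝ (Fin 3)))) :=
    (FemtoTransferGap.TwoLattice.GnChart.measurePreserving_curry_pi (Fin (2 * L - 1)) (Edge 3 L) (EuclideanSpace ℝ (Fin 3)) volume).comp (hB (Fin (2 * L - 1) × Edge 3 L))
  -- sum splittings and the enumeration
  have hS₃ := measurePreserving_sumPiEquivProdPi
    (fun _ : ((Fin (2 * L - 1) × Edge 3 L) × Fin 3) ⊕ ({y : Site 3 L // ¬ y = y₀} × Fin 3) => (volume : Measure ℝ))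
  have hS₂ := measurePreserving_sumPiEquivProdPi
    (fun _ : ({i : OffIdx L // ¬ i = e₀} × Fin 3) ⊕ (((Fin (2 * L - 1) × Edge 3 L) × Fin 3) ⊕ ({y : Site 3 L // ¬ y = y₀} × Fin 3)) =>
      (volume : Measure ℝ))
  have hS₁ := measurePreserving_sumPiEquivProdPi (fun _ : FixIdx L e₀ y₀ => (volume : Measure ℝ))
  have hR := (measurePreserving_piCongrLeft (fun _ : Fin (fixDim L e₀ y₀) => (volume : Measure ℝ)) (fixIdxEquiv L e₀ y₀)).symm
  have h0 := EuclideanSpace.volume_preserving_symm_measurableEquiv_toLp (Fin (fixDim L e₀ y₀))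
  have hT := (((hE.prod ((hB₁.prod ((hB₂.prod hB₃).comp hS₃)).comp hS₂)).comp hS₁).comp hR).comp h0
  have hfun : ((Prod.map (@toLp 2 (Fin 3 → ℝ))
      (Prod.map (fun (a : {i : OffIdx L // ¬ i = e₀} × Fin 3 → ℝ) (i : {i : OffIdx L // ¬ i = e₀}) =>
          (toLp 2 (Function.curry a i) : EuclideanSpace ℝ (Fin 3)))
        ((Prod.map (fun (a : (Fin (2 * L - 1) × Edge 3 L) × Fin 3 → ℝ) (j : Fin (2 * L - 1)) (e : Edge 3 L) =>
            (toLp 2 (Function.curry a (j, e)) : EuclideanSpace ℝ (Fin 3)))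
          (fun (a : {y : Site 3 L // ¬ y = y₀} × Fin 3 → ℝ) (i : {y : Site 3 L // ¬ y = y₀}) =>
            (toLp 2 (Function.curry a i) : EuclideanSpace ℝ (Fin 3)))) ∘
          ⇑(MeasurableEquiv.sumPiEquivProdPi fun _ : ((Fin (2 * L - 1) × Edge 3 L) × Fin 3) ⊕ ({y : Site 3 L // ¬ y = y₀} × Fin 3) => ℝ)) ∘
        ⇑(MeasurableEquiv.sumPiEquivProdPi fun _ : ({i : OffIdx L // ¬ i = e₀} × Fin 3) ⊕
          (((Fin (2 * L - 1) × Edge 3 L) × Fin 3) ⊕ ({y : Site 3 L // ¬ y = y₀} × Fin 3)) => ℝ)) ∘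
      ⇑(MeasurableEquiv.sumPiEquivProdPi fun _ : FixIdx L e₀ y₀ => ℝ)) ∘
      ⇑(MeasurableEquiv.piCongrLeft (fun _ : Fin (fixDim L e₀ y₀) => ℝ) (fixIdxEquiv L e₀ y₀)).symm) ∘
      ⇑(MeasurableEquiv.toLp 2 (Fin (fixDim L e₀ y₀) → ℝ)).symm = fixCoord := by
    funext y
    rfl
  rw [hfun] at hT
  unfold restLebesgue
  exact hT

/-! ## §4 `fixCoord` is a measurable embedding (explicit inverse) -/

/-- ★ `fixCoord` is a measurable embedding (in fact a measurable equivalence; the inverse reads the blocks back). [folklore] -/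
theorem measurableEmbedding_fixCoord : MeasurableEmbedding (fixCoord (L := L) (e₀ := e₀) (y₀ := y₀)) := by
  let rd : EuclideanSpace ℝ (Fin 3) × RestParam L e₀ y₀ → FixIdx L e₀ y₀ → ℝ := fun p idx =>
    Sum.elim (fun m => p.1 m) (Sum.elim (fun im : {i : OffIdx L // ¬ i = e₀} × Fin 3 => p.2.1 im.1 im.2)
      (Sum.elim (fun jem : (Fin (2 * L - 1) × Edge 3 L) × Fin 3 => p.2.2.1 jem.1.1 jem.1.2 jem.2)
        (fun sm : {y : Site 3 L // ¬ y = y₀} × Fin 3 => p.2.2.2 sm.1 sm.2))) idx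
  let inv : EuclideanSpace ℝ (Fin 3) × RestParam L e₀ y₀ → EuclideanSpace ℝ (Fin (fixDim L e₀ y₀)) := fun p =>
    toLp 2 fun k => rd p ((fixIdxEquiv L e₀ y₀).symm k)
  have hinv_apply : ∀ p idx, inv p (fixIdxEquiv L e₀ y₀ idx) = rd p idx := fun p idx => by
    show rd p ((fixIdxEquiv L e₀ y₀).symm (fixIdxEquiv L e₀ y₀ idx)) = rd p idx
    rw [Equiv.symm_apply_apply]
  have hleft : Function.LeftInverse inv fixCoord := fun y => by
    ext k
    obtain ⟨idx, rfl⟩ := (fixIdxEquiv L e₀ y₀).surjective k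
    rw [hinv_apply]
    rcases idx with m | ⟨i, m⟩ | ⟨⟨j, e⟩, m⟩ | ⟨s, m⟩ <;> rfl
  have hright : Function.RightInverse inv fixCoord := fun p => by
    refine Prod.ext ?_ (Prod.ext ?_ (Prod.ext ?_ ?_))
    · ext m; rw [fixCoord_fst_apply, hinv_apply]; rfl
    · funext i; ext m; rw [fixCoord_snd_fst_apply, hinv_apply]; rfl
    · funext j e; ext m; rw [fixCoord_snd_snd_fst_apply, hinv_apply]; rfl
    · funext s; ext m; rw [fixCoord_snd_snd_snd_apply, hinv_apply]; rfl
  have hc3 : ∀ m : Fin 3, Measurable fun x : EuclideanSpace ℝ (Fin 3) => x m := fun m =>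
    (EuclideanSpace.proj m : EuclideanSpace ℝ (Fin 3) →L[ℝ] ℝ).continuous.measurable
  have hrd : ∀ idx, Measurable fun p : EuclideanSpace ℝ (Fin 3) × RestParam L e₀ y₀ => rd p idx := by
    intro idx
    rcases idx with m | ⟨i, m⟩ | ⟨⟨j, e⟩, m⟩ | ⟨s, m⟩
    · exact (hc3 m).comp measurable_fst
    · exact (hc3 m).comp ((measurable_pi_apply i).comp (measurable_fst.comp measurable_snd))
    · exact (hc3 m).comp ((measurable_pi_apply e).comp ((measurable_pi_apply j).comp
        (measurable_fst.comp (measurable_snd.comp measurable_snd))))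
    · exact (hc3 m).comp ((measurable_pi_apply s).comp (measurable_snd.comp (measurable_snd.comp measurable_snd)))
  have hinv : Measurable inv := (WithLp.measurable_toLp 2 _).comp (measurable_pi_lambda _ fun k => hrd _)
  let e : EuclideanSpace ℝ (Fin (fixDim L e₀ y₀)) ≃ᵐ EuclideanSpace ℝ (Fin 3) × RestParam L e₀ y₀ :=
    { toFun := fixCoord, invFun := inv, left_inv := hleft, right_inv := hright,
      measurable_toFun := measurable_fixCoord, measurable_invFun := hinv }
  exact e.measurableEmbedding

end Summit.QuantumFields.YangMills.Theorems.VirialFluxGap.FixSplit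

end
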